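import Summits.Ventures.YMGap.Thresholds.OneLinkSDQuadVariance
import Summits.Ventures.YMGap.Thresholds.OneLinkOmegaBound
import HarnessLib

/-!
# Venture YMGap — the one-link modulus beyond first order, part 34: the `L²(ν_B)` norms of `tr(gΔgB)` and `tr(gBgB)` in closed
# form and their `N`-uniform scale `τ(N, r)`

HONEST FRAMING: venture file of the cell `pub-ymgap` (QuantumFields programme), strong-coupling LATTICE bookkeeping for `SU(N)`
lattice Yang–Mills; nothing about the continuum or the mass gap in the Clay sense.  No number of record moves here.

WHAT.  `ν_B(dg) ∝ exp(N Re tr(gB)) dg`, `N ≥ 3`, `r = ‖B‖_op`, `a = 2N − 4/N`, `s_B = ‖B‖_F/2 + √(‖B‖_F²/4 + 1/N)`,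
`b₀ = N r(‖B‖_F + r s_B)`, `c₀ = 4r² + 2‖B‖_F² s_B²`, `W_{M₁M₂} = √(E_ν|tr(gM₁gM₂)|²)`.
* `le_scale_of_sq_le`: real lemma `aW² ≤ n²c₀ + n b₀ W ⇒ W ≤ n(b₀/(2a) + √(b₀²/(4a²) + c₀/a))`;
* `sqrt_integral_normSq_quadDB_le`: `W_{ΔB} ≤ ‖Δ‖_F (b₀/(2a) + √(b₀²/(4a²) + c₀/a))` (from `quad_sd_sq_le` with `γ = 2r‖Δ‖_F`,
  `κ = 2r‖B‖_F‖Δ‖_F`, the Schwinger–Dyson second moments of `OneLinkSDVariance` for `tr(gΔ), tr(gB), tr(gBBᴴΔ), tr(gΔBᴴB)`);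
* `sqrt_integral_normSq_quadBB_le`: `W_{BB} ≤ ‖B‖_F (same bracket)`;
* `quad_scale_le`: for `‖B‖_F ≤ √N r`, `‖B‖_F·(bracket) ≤ N·τ(N,r)` with
  `τ(N,r) = r(b†/2 + √(b†²/4 + c†))`, `b† = r²(1 + r/2 + s)/(2 − 4/N²)`, `c† = r²(4/N² + 2(r/2+s)²)/(2 − 4/N²)`, `s = √(r²/4+1/N²)`
  (`τ` decreasing in `N`, increasing in `r`; `τ(10, 0.24) = 0.0231` against the sup scale `r² = 0.0576`);
* `sqrt_integral_normSq_quadBB_le_scale`: `W_{BB} ≤ N τ(N,r)`; `frobNorm_mul_sqrt_integral_normSq_quadDB_le`: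
  `‖B‖_F W_{ΔB} ≤ ‖Δ‖_F N τ(N,r)` — the two inputs of the quadratic-word refinement of the level-two modulus (next files).

References: cell note `HOME/p2/ONE-LINK-HIERARCHY.md` §13 option (2); Shen–Zhu–Zhu CMP 400 (2023) §4.1.
-/

noncomputable section

open scoped Matrix ComplexConjugate BigOperators ContDiff Matrix.Norms.Frobenius
open Matrix Complex Finset MeasureTheory ProbabilityTheory
open Literature.MathematicalPhysics.QuantumFieldTheory
open Literature.MathematicalPhysics.QuantumFieldTheory.SUNBakryEmery

namespace Summit.Ventures.YMGap.OneLinkEigen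

variable {N : ℕ}

/-- Real lemma: `a W² ≤ n² c₀ + n b₀ W` with `a > 0`, `n, W ≥ 0` gives `W ≤ n (b₀/(2a) + √(b₀²/(4a²) + c₀/a))`. [folklore] -/
theorem le_scale_of_sq_le {a n b₀ c₀ W : ℝ} (ha : 0 < a) (hn : 0 ≤ n) (h : a * W ^ 2 ≤ n ^ 2 * c₀ + n * b₀ * W) :
    W ≤ n * (b₀ / (2 * a) + Real.sqrt (b₀ ^ 2 / (4 * a ^ 2) + c₀ / a)) := by
  have h1 : W ^ 2 ≤ n ^ 2 * c₀ / a + (n * b₀ / a) * W := by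
    rw [show n ^ 2 * c₀ / a + n * b₀ / a * W = (n ^ 2 * c₀ + n * b₀ * W) / a by ring, le_div_iff₀ ha]
    linarith only [h]
  have h2 := le_of_sq_le_add_mul h1
  have e1 : (n * b₀ / a) ^ 2 / 4 + n ^ 2 * c₀ / a = n ^ 2 * (b₀ ^ 2 / (4 * a ^ 2) + c₀ / a) := by
    field_simp
  have e2 : Real.sqrt (n ^ 2 * (b₀ ^ 2 / (4 * a ^ 2) + c₀ / a)) = n * Real.sqrt (b₀ ^ 2 / (4 * a ^ 2) + c₀ / a) := by
    rw [Real.sqrt_mul (sq_nonneg n), Real.sqrt_sq hn]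
  rw [e1, e2] at h2
  have e3 : n * b₀ / a / 2 = n * (b₀ / (2 * a)) := by field_simp
  rw [e3] at h2
  linarith only [h2]

/-- **`√E|tr(gΔgB)|² ≤ ‖Δ‖_F (b₀/(2a) + √(b₀²/(4a²) + c₀/a))`**, `N ≥ 3`, every `B, Δ`. [folklore] -/
theorem sqrt_integral_normSq_quadDB_le (hN : 3 ≤ N) (B Δ : Matrix (Fin N) (Fin N) ℂ) :
    Real.sqrt (∫ g, ‖((g : Matrix (Fin N) (Fin N) ℂ) * Δ * (g : Matrix (Fin N) (Fin N) ℂ) * B).trace‖ ^ 2 ∂(haarProbability (SUN N)).tilted (fun g => (N : ℝ) * ((g : Matrix (Fin N) (Fin N) ℂ) * B).trace.re)) ≤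
      frobNorm Δ * (((N : ℝ) * matrixOpNorm B * (frobNorm B + matrixOpNorm B * (frobNorm B / 2 + Real.sqrt (frobNorm B ^ 2 / 4 + 1 / N)))) / (2 * (2 * (N : ℝ) - 4 / N)) + Real.sqrt (((N : ℝ) * matrixOpNorm B * (frobNorm B + matrixOpNorm B * (frobNorm B / 2 + Real.sqrt (frobNorm B ^ 2 / 4 + 1 / N)))) ^ 2 / (4 * (2 * (N : ℝ) - 4 / N) ^ 2) + (4 * matrixOpNorm B ^ 2 + 2 * frobNorm B ^ 2 * (frobNorm B / 2 + Real.sqrt (frobNorm B ^ 2 / 4 + 1 / N)) ^ 2) / (2 * (N : ℝ) - 4 / N))) := by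
  have hN0 : N ≠ 0 := by omega
  have h3 : (3 : ℝ) ≤ N := by exact_mod_cast hN
  have hNpos : (0 : ℝ) < N := by linarith
  set ν : Measure (SUN N) := (haarProbability (SUN N)).tilted (fun g => (N : ℝ) * ((g : Matrix (Fin N) (Fin N) ℂ) * B).trace.re) with hν
  set r : ℝ := matrixOpNorm B with hr
  set nB : ℝ := frobNorm B with hnB
  set nD : ℝ := frobNorm Δ with hnD
  set sB : ℝ := nB / 2 + Real.sqrt (nB ^ 2 / 4 + 1 / N) with hsB
  have hr0 : 0 ≤ r := matrixOpNorm_nonneg B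
  have hnB0 : 0 ≤ nB := frobNorm_nonneg B
  have hnD0 : 0 ≤ nD := frobNorm_nonneg Δ
  have hsB0 : 0 ≤ sB := by rw [hsB]; positivity
  have ha : 0 < 2 * (N : ℝ) - 4 / N := by
    have : (4 : ℝ) / N ≤ 4 / 3 := by rw [div_le_div_iff₀ hNpos (by norm_num)]; linarith
    linarith
  have hrH : matrixOpNorm Bᴴ = r := by rw [matrixOpNorm_conjTranspose]
  -- the pointwise inputs γ = 2 r nD, κ = 2 r nB nD
  have hγ : ∀ g : SUN N, frobNorm (Δ * (g : Matrix (Fin N) (Fin N) ℂ) * B + B * (g : Matrix (Fin N) (Fin N) ℂ) * Δ) ≤ 2 * r * nD := by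
    intro g
    have hg := SUN.mem_unitaryGroup g
    have h1 : frobNorm (Δ * (g : Matrix (Fin N) (Fin N) ℂ) * B) ≤ nD * r := by
      refine (frobNorm_mul_le_mul_matrixOpNorm _ _).trans ?_
      rw [frobNorm_mul_unitary _ hg]
    have h2 : frobNorm (B * (g : Matrix (Fin N) (Fin N) ℂ) * Δ) ≤ r * nD := by
      rw [Matrix.mul_assoc]
      refine (frobNorm_mul_le_matrixOpNorm_mul _ _).trans ?_
      rw [frobNorm_unitary_mul hg]
    refine (frobNorm_add_le _ _).trans ?_
    linarith only [h1, h2]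
  have hκ : ∀ g : SUN N, ‖(B * (g : Matrix (Fin N) (Fin N) ℂ) * Δ * (g : Matrix (Fin N) (Fin N) ℂ) * B * (g : Matrix (Fin N) (Fin N) ℂ)).trace‖ +
      ‖(B * (g : Matrix (Fin N) (Fin N) ℂ) * B * (g : Matrix (Fin N) (Fin N) ℂ) * Δ * (g : Matrix (Fin N) (Fin N) ℂ)).trace‖ ≤ 2 * r * nB * nD := by
    intro g
    have hg := SUN.mem_unitaryGroup g
    have hBgD : frobNorm (B * (g : Matrix (Fin N) (Fin N) ℂ) * Δ) ≤ r * nD := by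
      rw [Matrix.mul_assoc]
      refine (frobNorm_mul_le_matrixOpNorm_mul _ _).trans ?_
      rw [frobNorm_unitary_mul hg]
    have hgBg : frobNorm ((g : Matrix (Fin N) (Fin N) ℂ) * B * (g : Matrix (Fin N) (Fin N) ℂ)) = nB := by
      rw [frobNorm_mul_unitary _ hg, frobNorm_unitary_mul hg]
    have hBgBg : frobNorm (B * (g : Matrix (Fin N) (Fin N) ℂ) * B * (g : Matrix (Fin N) (Fin N) ℂ)) ≤ r * nB := by
      rw [show B * (g : Matrix (Fin N) (Fin N) ℂ) * B * g = B * ((g : Matrix (Fin N) (Fin N) ℂ) * B * (g : Matrix (Fin N) (Fin N) ℂ)) by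
        simp only [Matrix.mul_assoc]]
      refine (frobNorm_mul_le_matrixOpNorm_mul _ _).trans ?_
      rw [hgBg]
    have hDg : frobNorm (Δ * (g : Matrix (Fin N) (Fin N) ℂ)) = nD := frobNorm_mul_unitary _ hg
    have t1 : ‖(B * (g : Matrix (Fin N) (Fin N) ℂ) * Δ * (g : Matrix (Fin N) (Fin N) ℂ) * B * (g : Matrix (Fin N) (Fin N) ℂ)).trace‖ ≤ r * nD * nB := by
      rw [show B * (g : Matrix (Fin N) (Fin N) ℂ) * Δ * (g : Matrix (Fin N) (Fin N) ℂ) * B * g =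
        (B * (g : Matrix (Fin N) (Fin N) ℂ) * Δ) * ((g : Matrix (Fin N) (Fin N) ℂ) * B * (g : Matrix (Fin N) (Fin N) ℂ)) by simp only [Matrix.mul_assoc]]
      refine (norm_trace_mul_le _ _).trans ?_
      rw [hgBg]
      exact mul_le_mul_of_nonneg_right hBgD hnB0
    have t2 : ‖(B * (g : Matrix (Fin N) (Fin N) ℂ) * B * (g : Matrix (Fin N) (Fin N) ℂ) * Δ * (g : Matrix (Fin N) (Fin N) ℂ)).trace‖ ≤ r * nB * nD := by
      rw [show B * (g : Matrix (Fin N) (Fin N) ℂ) * B * (g : Matrix (Fin N) (Fin N) ℂ) * Δ * g =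
        (B * (g : Matrix (Fin N) (Fin N) ℂ) * B * (g : Matrix (Fin N) (Fin N) ℂ)) * (Δ * (g : Matrix (Fin N) (Fin N) ℂ)) by simp only [Matrix.mul_assoc]]
      refine (norm_trace_mul_le _ _).trans ?_
      rw [hDg]
      exact mul_le_mul_of_nonneg_right hBgBg hnD0
    linarith only [t1, t2]
  -- the Schwinger–Dyson second moments of the linear words
  have hZD : Real.sqrt (∫ g, ‖((g : Matrix (Fin N) (Fin N) ℂ) * Δ).trace‖ ^ 2 ∂ν) ≤ nD * sB := sqrt_integral_normSq_trace_le_sd hN0 B Δ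
  have hZB : Real.sqrt (∫ g, ‖((g : Matrix (Fin N) (Fin N) ℂ) * B).trace‖ ^ 2 ∂ν) ≤ nB * sB := sqrt_integral_normSq_trace_le_sd hN0 B B
  have hL1 : Real.sqrt (∫ g, ‖((g : Matrix (Fin N) (Fin N) ℂ) * (B * Bᴴ * Δ)).trace‖ ^ 2 ∂ν) ≤ r ^ 2 * nD * sB := by
    refine (sqrt_integral_normSq_trace_le_sd hN0 B (B * Bᴴ * Δ)).trans ?_
    have h1 : frobNorm (B * Bᴴ * Δ) ≤ r ^ 2 * nD := by
      rw [Matrix.mul_assoc]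
      refine (frobNorm_mul_le_matrixOpNorm_mul _ _).trans ?_
      have h2 : frobNorm (Bᴴ * Δ) ≤ r * nD := by
        refine (frobNorm_mul_le_matrixOpNorm_mul _ _).trans ?_; rw [hrH]
      calc matrixOpNorm B * frobNorm (Bᴴ * Δ) ≤ r * (r * nD) := mul_le_mul_of_nonneg_left h2 hr0
        _ = r ^ 2 * nD := by ring
    exact mul_le_mul_of_nonneg_right h1 hsB0
  have hL2 : Real.sqrt (∫ g, ‖((g : Matrix (Fin N) (Fin N) ℂ) * (Δ * Bᴴ * B)).trace‖ ^ 2 ∂ν) ≤ r ^ 2 * nD * sB := by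
    refine (sqrt_integral_normSq_trace_le_sd hN0 B (Δ * Bᴴ * B)).trans ?_
    have h1 : frobNorm (Δ * Bᴴ * B) ≤ r ^ 2 * nD := by
      refine (frobNorm_mul_le_mul_matrixOpNorm _ _).trans ?_
      have h2 : frobNorm (Δ * Bᴴ) ≤ nD * r := by
        refine (frobNorm_mul_le_mul_matrixOpNorm _ _).trans ?_; rw [hrH]
      calc frobNorm (Δ * Bᴴ) * matrixOpNorm B ≤ (nD * r) * r := mul_le_mul_of_nonneg_right h2 hr0
        _ = r ^ 2 * nD := by ring
    exact mul_le_mul_of_nonneg_right h1 hsB0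
  -- assemble
  have hsd := quad_sd_sq_le hN B Δ B hγ hκ
  rw [← hν, ← hnB, ← hnD] at hsd
  set W : ℝ := Real.sqrt (∫ g, ‖((g : Matrix (Fin N) (Fin N) ℂ) * Δ * (g : Matrix (Fin N) (Fin N) ℂ) * B).trace‖ ^ 2 ∂ν) with hW
  have hW0 : 0 ≤ W := Real.sqrt_nonneg _
  have hWW : W ^ 2 = ∫ g, ‖((g : Matrix (Fin N) (Fin N) ℂ) * Δ * (g : Matrix (Fin N) (Fin N) ℂ) * B).trace‖ ^ 2 ∂ν :=
    Real.sq_sqrt (integral_nonneg fun g => sq_nonneg _)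
  rw [← hWW] at hsd
  have hZZ : Real.sqrt (∫ g, ‖((g : Matrix (Fin N) (Fin N) ℂ) * Δ).trace‖ ^ 2 ∂ν) *
      Real.sqrt (∫ g, ‖((g : Matrix (Fin N) (Fin N) ℂ) * B).trace‖ ^ 2 ∂ν) ≤ (nD * sB) * (nB * sB) :=
    mul_le_mul hZD hZB (Real.sqrt_nonneg _) (by positivity)
  have hmain : (2 * (N : ℝ) - 4 / N) * W ^ 2 ≤
      nD ^ 2 * (4 * r ^ 2 + 2 * nB ^ 2 * sB ^ 2) + nD * ((N : ℝ) * r * (nB + r * sB)) * W := by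
    have m1 := mul_le_mul_of_nonneg_left hZZ (by positivity : (0 : ℝ) ≤ 2 * (nD * nB))
    have m2 : (N : ℝ) / 2 * (2 * r * nB * nD +
        Real.sqrt (∫ g, ‖((g : Matrix (Fin N) (Fin N) ℂ) * (B * Bᴴ * Δ)).trace‖ ^ 2 ∂ν) +
        Real.sqrt (∫ g, ‖((g : Matrix (Fin N) (Fin N) ℂ) * (Δ * Bᴴ * B)).trace‖ ^ 2 ∂ν)) * W ≤
        (N : ℝ) / 2 * (2 * r * nB * nD + r ^ 2 * nD * sB + r ^ 2 * nD * sB) * W :=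
      mul_le_mul_of_nonneg_right (mul_le_mul_of_nonneg_left (by linarith only [hL1, hL2]) (by positivity)) hW0
    have e : (2 * r * nD) ^ 2 + 2 * (nD * nB) * ((nD * sB) * (nB * sB))
        + (N : ℝ) / 2 * (2 * r * nB * nD + r ^ 2 * nD * sB + r ^ 2 * nD * sB) * W =
        nD ^ 2 * (4 * r ^ 2 + 2 * nB ^ 2 * sB ^ 2) + nD * ((N : ℝ) * r * (nB + r * sB)) * W := by ring
    linarith only [hsd, m1, m2, e]
  exact le_scale_of_sq_le ha hnD0 hmain

/-- **`√E|tr(gBgB)|² ≤ ‖B‖_F (b₀/(2a) + √(b₀²/(4a²) + c₀/a))`**, `N ≥ 3`, every `B`. [folklore] -/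
theorem sqrt_integral_normSq_quadBB_le (hN : 3 ≤ N) (B : Matrix (Fin N) (Fin N) ℂ) :
    Real.sqrt (∫ g, ‖((g : Matrix (Fin N) (Fin N) ℂ) * B * (g : Matrix (Fin N) (Fin N) ℂ) * B).trace‖ ^ 2 ∂(haarProbability (SUN N)).tilted (fun g => (N : ℝ) * ((g : Matrix (Fin N) (Fin N) ℂ) * B).trace.re)) ≤
      frobNorm B * (((N : ℝ) * matrixOpNorm B * (frobNorm B + matrixOpNorm B * (frobNorm B / 2 + Real.sqrt (frobNorm B ^ 2 / 4 + 1 / N)))) / (2 * (2 * (N : ℝ) - 4 / N)) + Real.sqrt (((N : ℝ) * matrixOpNorm B * (frobNorm B + matrixOpNorm B * (frobNorm B / 2 + Real.sqrt (frobNorm B ^ 2 / 4 + 1 / N)))) ^ 2 / (4 * (2 * (N : ℝ) - 4 / N) ^ 2) + (4 * matrixOpNorm B ^ 2 + 2 * frobNorm B ^ 2 * (frobNorm B / 2 + Real.sqrt (frobNorm B ^ 2 / 4 + 1 / N)) ^ 2) / (2 * (N : ℝ) - 4 / N))) := by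
  have hN0 : N ≠ 0 := by omega
  have h3 : (3 : ℝ) ≤ N := by exact_mod_cast hN
  have hNpos : (0 : ℝ) < N := by linarith
  set ν : Measure (SUN N) := (haarProbability (SUN N)).tilted (fun g => (N : ℝ) * ((g : Matrix (Fin N) (Fin N) ℂ) * B).trace.re) with hν
  set r : ℝ := matrixOpNorm B with hr
  set nB : ℝ := frobNorm B with hnB
  set sB : ℝ := nB / 2 + Real.sqrt (nB ^ 2 / 4 + 1 / N) with hsB
  have hr0 : 0 ≤ r := matrixOpNorm_nonneg B
  have hnB0 : 0 ≤ nB := frobNorm_nonneg B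
  have hsB0 : 0 ≤ sB := by rw [hsB]; positivity
  have ha : 0 < 2 * (N : ℝ) - 4 / N := by
    have : (4 : ℝ) / N ≤ 4 / 3 := by rw [div_le_div_iff₀ hNpos (by norm_num)]; linarith
    linarith
  have hrH : matrixOpNorm Bᴴ = r := by rw [matrixOpNorm_conjTranspose]
  have hBgB : ∀ g : SUN N, frobNorm (B * (g : Matrix (Fin N) (Fin N) ℂ) * B) ≤ r * nB := by
    intro g
    have hg := SUN.mem_unitaryGroup g
    rw [Matrix.mul_assoc]
    refine (frobNorm_mul_le_matrixOpNorm_mul _ _).trans ?_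
    rw [frobNorm_unitary_mul hg]
  have hγ : ∀ g : SUN N, frobNorm (B * (g : Matrix (Fin N) (Fin N) ℂ) * B + B * (g : Matrix (Fin N) (Fin N) ℂ) * B) ≤ 2 * r * nB := by
    intro g
    refine (frobNorm_add_le _ _).trans ?_
    linarith only [hBgB g]
  have hκ : ∀ g : SUN N, ‖(B * (g : Matrix (Fin N) (Fin N) ℂ) * B * (g : Matrix (Fin N) (Fin N) ℂ) * B * (g : Matrix (Fin N) (Fin N) ℂ)).trace‖ +
      ‖(B * (g : Matrix (Fin N) (Fin N) ℂ) * B * (g : Matrix (Fin N) (Fin N) ℂ) * B * (g : Matrix (Fin N) (Fin N) ℂ)).trace‖ ≤ 2 * r * nB * nB := by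
    intro g
    have hg := SUN.mem_unitaryGroup g
    have hgBg : frobNorm ((g : Matrix (Fin N) (Fin N) ℂ) * B * (g : Matrix (Fin N) (Fin N) ℂ)) = nB := by
      rw [frobNorm_mul_unitary _ hg, frobNorm_unitary_mul hg]
    have t1 : ‖(B * (g : Matrix (Fin N) (Fin N) ℂ) * B * (g : Matrix (Fin N) (Fin N) ℂ) * B * (g : Matrix (Fin N) (Fin N) ℂ)).trace‖ ≤ r * nB * nB := by
      rw [show B * (g : Matrix (Fin N) (Fin N) ℂ) * B * (g : Matrix (Fin N) (Fin N) ℂ) * B * g =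
        (B * (g : Matrix (Fin N) (Fin N) ℂ) * B) * ((g : Matrix (Fin N) (Fin N) ℂ) * B * (g : Matrix (Fin N) (Fin N) ℂ)) by simp only [Matrix.mul_assoc]]
      refine (norm_trace_mul_le _ _).trans ?_
      rw [hgBg]
      exact mul_le_mul_of_nonneg_right (hBgB g) hnB0
    linarith only [t1]
  have hZB : Real.sqrt (∫ g, ‖((g : Matrix (Fin N) (Fin N) ℂ) * B).trace‖ ^ 2 ∂ν) ≤ nB * sB := sqrt_integral_normSq_trace_le_sd hN0 B B
  have hL : Real.sqrt (∫ g, ‖((g : Matrix (Fin N) (Fin N) ℂ) * (B * Bᴴ * B)).trace‖ ^ 2 ∂ν) ≤ r ^ 2 * nB * sB := by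
    refine (sqrt_integral_normSq_trace_le_sd hN0 B (B * Bᴴ * B)).trans ?_
    have h1 : frobNorm (B * Bᴴ * B) ≤ r ^ 2 * nB := by
      rw [Matrix.mul_assoc]
      refine (frobNorm_mul_le_matrixOpNorm_mul _ _).trans ?_
      have h2 : frobNorm (Bᴴ * B) ≤ r * nB := by
        refine (frobNorm_mul_le_matrixOpNorm_mul _ _).trans ?_; rw [hrH]
      calc matrixOpNorm B * frobNorm (Bᴴ * B) ≤ r * (r * nB) := mul_le_mul_of_nonneg_left h2 hr0
        _ = r ^ 2 * nB := by ring
    exact mul_le_mul_of_nonneg_right h1 hsB0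
  have hsd := quad_sd_sq_le hN B B B hγ hκ
  rw [← hν, ← hnB] at hsd
  set W : ℝ := Real.sqrt (∫ g, ‖((g : Matrix (Fin N) (Fin N) ℂ) * B * (g : Matrix (Fin N) (Fin N) ℂ) * B).trace‖ ^ 2 ∂ν) with hW
  have hW0 : 0 ≤ W := Real.sqrt_nonneg _
  have hWW : W ^ 2 = ∫ g, ‖((g : Matrix (Fin N) (Fin N) ℂ) * B * (g : Matrix (Fin N) (Fin N) ℂ) * B).trace‖ ^ 2 ∂ν :=
    Real.sq_sqrt (integral_nonneg fun g => sq_nonneg _)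
  rw [← hWW] at hsd
  have hZZ : Real.sqrt (∫ g, ‖((g : Matrix (Fin N) (Fin N) ℂ) * B).trace‖ ^ 2 ∂ν) *
      Real.sqrt (∫ g, ‖((g : Matrix (Fin N) (Fin N) ℂ) * B).trace‖ ^ 2 ∂ν) ≤ (nB * sB) * (nB * sB) :=
    mul_le_mul hZB hZB (Real.sqrt_nonneg _) (by positivity)
  have hmain : (2 * (N : ℝ) - 4 / N) * W ^ 2 ≤
      nB ^ 2 * (4 * r ^ 2 + 2 * nB ^ 2 * sB ^ 2) + nB * ((N : ℝ) * r * (nB + r * sB)) * W := by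
    have m1 := mul_le_mul_of_nonneg_left hZZ (by positivity : (0 : ℝ) ≤ 2 * (nB * nB))
    have m2 : (N : ℝ) / 2 * (2 * r * nB * nB +
        Real.sqrt (∫ g, ‖((g : Matrix (Fin N) (Fin N) ℂ) * (B * Bᴴ * B)).trace‖ ^ 2 ∂ν) +
        Real.sqrt (∫ g, ‖((g : Matrix (Fin N) (Fin N) ℂ) * (B * Bᴴ * B)).trace‖ ^ 2 ∂ν)) * W ≤
        (N : ℝ) / 2 * (2 * r * nB * nB + r ^ 2 * nB * sB + r ^ 2 * nB * sB) * W :=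
      mul_le_mul_of_nonneg_right (mul_le_mul_of_nonneg_left (by linarith only [hL]) (by positivity)) hW0
    have e : (2 * r * nB) ^ 2 + 2 * (nB * nB) * ((nB * sB) * (nB * sB))
        + (N : ℝ) / 2 * (2 * r * nB * nB + r ^ 2 * nB * sB + r ^ 2 * nB * sB) * W =
        nB ^ 2 * (4 * r ^ 2 + 2 * nB ^ 2 * sB ^ 2) + nB * ((N : ℝ) * r * (nB + r * sB)) * W := by ring
    linarith only [hsd, m1, m2, e]
  exact le_scale_of_sq_le ha hnB0 hmain

/-! ### The `N`-uniform scale `τ(N, r)` -/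

/-- **The scale envelope**: for `‖B‖_F ≤ √N r` (`r = ‖B‖_op`), `‖B‖_F·(b₀/(2a) + √(b₀²/(4a²) + c₀/a)) ≤ N·τ(N, r)`. [folklore] -/
theorem quad_scale_le (hN : 3 ≤ N) (B : Matrix (Fin N) (Fin N) ℂ) :
    frobNorm B * (((N : ℝ) * matrixOpNorm B * (frobNorm B + matrixOpNorm B * (frobNorm B / 2 + Real.sqrt (frobNorm B ^ 2 / 4 + 1 / N)))) / (2 * (2 * (N : ℝ) - 4 / N)) + Real.sqrt (((N : ℝ) * matrixOpNorm B * (frobNorm B + matrixOpNorm B * (frobNorm B / 2 + Real.sqrt (frobNorm B ^ 2 / 4 + 1 / N)))) ^ 2 / (4 * (2 * (N : ℝ) - 4 / N) ^ 2) + (4 * matrixOpNorm B ^ 2 + 2 * frobNorm B ^ 2 * (frobNorm B / 2 + Real.sqrt (frobNorm B ^ 2 / 4 + 1 / N)) ^ 2) / (2 * (N : ℝ) - 4 / N))) ≤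
      (N : ℝ) * (matrixOpNorm B * ((matrixOpNorm B ^ 2 * (1 + matrixOpNorm B / 2 + Real.sqrt (matrixOpNorm B ^ 2 / 4 + 1 / (N : ℝ) ^ 2)) / (2 - 4 / (N : ℝ) ^ 2)) / 2 + Real.sqrt ((matrixOpNorm B ^ 2 * (1 + matrixOpNorm B / 2 + Real.sqrt (matrixOpNorm B ^ 2 / 4 + 1 / (N : ℝ) ^ 2)) / (2 - 4 / (N : ℝ) ^ 2)) ^ 2 / 4 + (matrixOpNorm B ^ 2 * (4 / (N : ℝ) ^ 2 + 2 * (matrixOpNorm B / 2 + Real.sqrt (matrixOpNorm B ^ 2 / 4 + 1 / (N : ℝ) ^ 2)) ^ 2) / (2 - 4 / (N : ℝ) ^ 2))))) := by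
  have hN0 : N ≠ 0 := by omega
  have h3 : (3 : ℝ) ≤ N := by exact_mod_cast hN
  have hNpos : (0 : ℝ) < N := by linarith
  have hNne : (N : ℝ) ≠ 0 := hNpos.ne'
  set r : ℝ := matrixOpNorm B with hr
  set nB : ℝ := frobNorm B with hnB
  set s : ℝ := Real.sqrt (r ^ 2 / 4 + 1 / (N : ℝ) ^ 2) with hs
  set sB : ℝ := nB / 2 + Real.sqrt (nB ^ 2 / 4 + 1 / N) with hsB
  set d : ℝ := 2 - 4 / (N : ℝ) ^ 2 with hd
  set a : ℝ := 2 * (N : ℝ) - 4 / N with ha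
  set bd : ℝ := r ^ 2 * (1 + r / 2 + s) / d with hbd
  set cd : ℝ := r ^ 2 * (4 / (N : ℝ) ^ 2 + 2 * (r / 2 + s) ^ 2) / d with hcd
  set b₀ : ℝ := (N : ℝ) * r * (nB + r * sB) with hb₀
  set c₀ : ℝ := 4 * r ^ 2 + 2 * nB ^ 2 * sB ^ 2 with hc₀
  have hr0 : 0 ≤ r := matrixOpNorm_nonneg B
  have hnB0 : 0 ≤ nB := frobNorm_nonneg B
  have hs0 : 0 ≤ s := Real.sqrt_nonneg _
  have hsB0 : 0 ≤ sB := by rw [hsB]; positivity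
  have hnBr : nB ≤ Real.sqrt N * r := frobNorm_le_sqrt_mul_matrixOpNorm B
  have hS2 : Real.sqrt N * Real.sqrt N = N := Real.mul_self_sqrt hNpos.le
  have hS0 : 0 ≤ Real.sqrt N := Real.sqrt_nonneg _
  have hd0 : 0 < d := by
    rw [hd]
    have : (4 : ℝ) / (N : ℝ) ^ 2 ≤ 4 / 9 := by
      rw [div_le_div_iff₀ (by positivity) (by norm_num)]; nlinarith only [h3]
    linarith
  have had : a = (N : ℝ) * d := by rw [ha, hd]; field_simp
  have ha0 : 0 < a := by rw [had]; positivity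
  have hbd0 : 0 ≤ bd := by rw [hbd]; positivity
  have hcd0 : 0 ≤ cd := by rw [hcd]; positivity
  have hsBle : sB ≤ Real.sqrt N * (r / 2 + s) := half_add_sqrt_le hNpos hnB0 hnBr hr0
  have hnB2 : nB ^ 2 ≤ N * r ^ 2 := by
    calc nB ^ 2 ≤ (Real.sqrt N * r) ^ 2 := pow_le_pow_left₀ hnB0 hnBr 2
      _ = (Real.sqrt N * Real.sqrt N) * r ^ 2 := by ring
      _ = N * r ^ 2 := by rw [hS2]
  -- (i) the linear part: nB b₀/(2a) ≤ N r bd/2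
  have hlin_core : nB * (nB + r * sB) ≤ (N : ℝ) * r ^ 2 * (1 + r / 2 + s) := by
    have t1 : nB * nB ≤ N * r ^ 2 := by nlinarith only [hnB2]
    have t2 : nB * sB ≤ (Real.sqrt N * r) * (Real.sqrt N * (r / 2 + s)) := mul_le_mul hnBr hsBle hsB0 (by positivity)
    have e2 : (Real.sqrt N * r) * (Real.sqrt N * (r / 2 + s)) = (Real.sqrt N * Real.sqrt N) * (r * (r / 2 + s)) := by ring
    rw [e2, hS2] at t2
    have t3 := mul_le_mul_of_nonneg_left t2 hr0
    nlinarith only [t1, t3]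
  have hlin : nB * (b₀ / (2 * a)) ≤ (N : ℝ) * (r * (bd / 2)) := by
    rw [hb₀, had, hbd]
    have e : nB * ((N : ℝ) * r * (nB + r * sB) / (2 * ((N : ℝ) * d))) = r * (nB * (nB + r * sB)) / (2 * d) := by
      field_simp
    rw [e, div_le_iff₀ (by positivity)]
    have := mul_le_mul_of_nonneg_left hlin_core hr0
    have e2 : (N : ℝ) * (r * (r ^ 2 * (1 + r / 2 + s) / d / 2)) * (2 * d) = r * ((N : ℝ) * r ^ 2 * (1 + r / 2 + s)) := by
      field_simp
    rw [e2]
    exact this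
  -- (ii) the square-root part
  have hsq1 : (nB * (b₀ / (2 * a))) ^ 2 ≤ ((N : ℝ) * (r * (bd / 2))) ^ 2 :=
    pow_le_pow_left₀ (by positivity) hlin 2
  have hsq2 : nB ^ 2 * (c₀ / a) ≤ (N : ℝ) ^ 2 * r ^ 2 * cd := by
    rw [hc₀, had, hcd]
    have hsB2 : sB ^ 2 ≤ N * (r / 2 + s) ^ 2 := by
      calc sB ^ 2 ≤ (Real.sqrt N * (r / 2 + s)) ^ 2 := pow_le_pow_left₀ hsB0 hsBle 2
        _ = (Real.sqrt N * Real.sqrt N) * (r / 2 + s) ^ 2 := by ring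
        _ = N * (r / 2 + s) ^ 2 := by rw [hS2]
    have t1 : nB ^ 2 * (4 * r ^ 2 + 2 * nB ^ 2 * sB ^ 2) ≤ (N * r ^ 2) * (4 * r ^ 2 + 2 * (N * r ^ 2) * (N * (r / 2 + s) ^ 2)) := by
      have u : nB ^ 2 * sB ^ 2 ≤ (N * r ^ 2) * (N * (r / 2 + s) ^ 2) := mul_le_mul hnB2 hsB2 (by positivity) (by positivity)
      nlinarith only [hnB2, u, sq_nonneg r, sq_nonneg nB, mul_nonneg (sq_nonneg nB) (sq_nonneg sB)]
    rw [show nB ^ 2 * ((4 * r ^ 2 + 2 * nB ^ 2 * sB ^ 2) / ((N : ℝ) * d)) =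
      nB ^ 2 * (4 * r ^ 2 + 2 * nB ^ 2 * sB ^ 2) / ((N : ℝ) * d) by ring, div_le_iff₀ (by positivity)]
    refine t1.trans (le_of_eq ?_)
    field_simp
  have hroot : nB * Real.sqrt (b₀ ^ 2 / (4 * a ^ 2) + c₀ / a) ≤ (N : ℝ) * (r * Real.sqrt (bd ^ 2 / 4 + cd)) := by
    have e1 : nB * Real.sqrt (b₀ ^ 2 / (4 * a ^ 2) + c₀ / a) = Real.sqrt ((nB * (b₀ / (2 * a))) ^ 2 + nB ^ 2 * (c₀ / a)) := by
      rw [show (nB * (b₀ / (2 * a))) ^ 2 + nB ^ 2 * (c₀ / a) = nB ^ 2 * (b₀ ^ 2 / (4 * a ^ 2) + c₀ / a) by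
        field_simp; ring, Real.sqrt_mul (sq_nonneg nB), Real.sqrt_sq hnB0]
    have e2 : (N : ℝ) * (r * Real.sqrt (bd ^ 2 / 4 + cd)) = Real.sqrt (((N : ℝ) * (r * (bd / 2))) ^ 2 + (N : ℝ) ^ 2 * r ^ 2 * cd) := by
      rw [show ((N : ℝ) * (r * (bd / 2))) ^ 2 + (N : ℝ) ^ 2 * r ^ 2 * cd = ((N : ℝ) * r) ^ 2 * (bd ^ 2 / 4 + cd) by ring,
        Real.sqrt_mul (sq_nonneg _), Real.sqrt_sq (by positivity)]
      ring
    rw [e1, e2]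
    exact Real.sqrt_le_sqrt (by linarith only [hsq1, hsq2])
  rw [mul_add]
  have e : (N : ℝ) * (r * (bd / 2 + Real.sqrt (bd ^ 2 / 4 + cd))) =
      (N : ℝ) * (r * (bd / 2)) + (N : ℝ) * (r * Real.sqrt (bd ^ 2 / 4 + cd)) := by ring
  rw [e]
  exact add_le_add hlin hroot

/-- **`√E|tr(gBgB)|² ≤ N τ(N, ‖B‖_op)`**, `N ≥ 3`, every `B`. [folklore] -/
theorem sqrt_integral_normSq_quadBB_le_scale (hN : 3 ≤ N) (B : Matrix (Fin N) (Fin N) ℂ) :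
    Real.sqrt (∫ g, ‖((g : Matrix (Fin N) (Fin N) ℂ) * B * (g : Matrix (Fin N) (Fin N) ℂ) * B).trace‖ ^ 2 ∂(haarProbability (SUN N)).tilted (fun g => (N : ℝ) * ((g : Matrix (Fin N) (Fin N) ℂ) * B).trace.re)) ≤
      (N : ℝ) * (matrixOpNorm B * ((matrixOpNorm B ^ 2 * (1 + matrixOpNorm B / 2 + Real.sqrt (matrixOpNorm B ^ 2 / 4 + 1 / (N : ℝ) ^ 2)) / (2 - 4 / (N : ℝ) ^ 2)) / 2 + Real.sqrt ((matrixOpNorm B ^ 2 * (1 + matrixOpNorm B / 2 + Real.sqrt (matrixOpNorm B ^ 2 / 4 + 1 / (N : ℝ) ^ 2)) / (2 - 4 / (N : ℝ) ^ 2)) ^ 2 / 4 + (matrixOpNorm B ^ 2 * (4 / (N : ℝ) ^ 2 + 2 * (matrixOpNorm B / 2 + Real.sqrt (matrixOpNorm B ^ 2 / 4 + 1 / (N : ℝ) ^ 2)) ^ 2) / (2 - 4 / (N : ℝ) ^ 2))))) :=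
  (sqrt_integral_normSq_quadBB_le hN B).trans (quad_scale_le hN B)

/-- **`‖B‖_F √E|tr(gΔgB)|² ≤ ‖Δ‖_F N τ(N, ‖B‖_op)`**, `N ≥ 3`, every `B, Δ`. [folklore] -/
theorem frobNorm_mul_sqrt_integral_normSq_quadDB_le (hN : 3 ≤ N) (B Δ : Matrix (Fin N) (Fin N) ℂ) :
    frobNorm B * Real.sqrt (∫ g, ‖((g : Matrix (Fin N) (Fin N) ℂ) * Δ * (g : Matrix (Fin N) (Fin N) ℂ) * B).trace‖ ^ 2 ∂(haarProbability (SUN N)).tilted (fun g => (N : ℝ) * ((g : Matrix (Fin N) (Fin N) ℂ) * B).trace.re)) ≤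
      frobNorm Δ * ((N : ℝ) * (matrixOpNorm B * ((matrixOpNorm B ^ 2 * (1 + matrixOpNorm B / 2 + Real.sqrt (matrixOpNorm B ^ 2 / 4 + 1 / (N : ℝ) ^ 2)) / (2 - 4 / (N : ℝ) ^ 2)) / 2 + Real.sqrt ((matrixOpNorm B ^ 2 * (1 + matrixOpNorm B / 2 + Real.sqrt (matrixOpNorm B ^ 2 / 4 + 1 / (N : ℝ) ^ 2)) / (2 - 4 / (N : ℝ) ^ 2)) ^ 2 / 4 + (matrixOpNorm B ^ 2 * (4 / (N : ℝ) ^ 2 + 2 * (matrixOpNorm B / 2 + Real.sqrt (matrixOpNorm B ^ 2 / 4 + 1 / (N : ℝ) ^ 2)) ^ 2) / (2 - 4 / (N : ℝ) ^ 2)))))) := by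
  have h := sqrt_integral_normSq_quadDB_le hN B Δ
  calc frobNorm B * Real.sqrt (∫ g, ‖((g : Matrix (Fin N) (Fin N) ℂ) * Δ * (g : Matrix (Fin N) (Fin N) ℂ) * B).trace‖ ^ 2 ∂(haarProbability (SUN N)).tilted (fun g => (N : ℝ) * ((g : Matrix (Fin N) (Fin N) ℂ) * B).trace.re))
      ≤ frobNorm B * (frobNorm Δ * (((N : ℝ) * matrixOpNorm B * (frobNorm B + matrixOpNorm B * (frobNorm B / 2 + Real.sqrt (frobNorm B ^ 2 / 4 + 1 / N)))) / (2 * (2 * (N : ℝ) - 4 / N)) + Real.sqrt (((N : ℝ) * matrixOpNorm B * (frobNorm B + matrixOpNorm B * (frobNorm B / 2 + Real.sqrt (frobNorm B ^ 2 / 4 + 1 / N)))) ^ 2 / (4 * (2 * (N : ℝ) - 4 / N) ^ 2) + (4 * matrixOpNorm B ^ 2 + 2 * frobNorm B ^ 2 * (frobNorm B / 2 + Real.sqrt (frobNorm B ^ 2 / 4 + 1 / N)) ^ 2) / (2 * (N : ℝ) - 4 / N)))) := mul_le_mul_of_nonneg_left h (frobNorm_nonneg B)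
    _ = frobNorm Δ * (frobNorm B * (((N : ℝ) * matrixOpNorm B * (frobNorm B + matrixOpNorm B * (frobNorm B / 2 + Real.sqrt (frobNorm B ^ 2 / 4 + 1 / N)))) / (2 * (2 * (N : ℝ) - 4 / N)) + Real.sqrt (((N : ℝ) * matrixOpNorm B * (frobNorm B + matrixOpNorm B * (frobNorm B / 2 + Real.sqrt (frobNorm B ^ 2 / 4 + 1 / N)))) ^ 2 / (4 * (2 * (N : ℝ) - 4 / N) ^ 2) + (4 * matrixOpNorm B ^ 2 + 2 * frobNorm B ^ 2 * (frobNorm B / 2 + Real.sqrt (frobNorm B ^ 2 / 4 + 1 / N)) ^ 2) / (2 * (N : ℝ) - 4 / N)))) := by ring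
    _ ≤ frobNorm Δ * ((N : ℝ) * (matrixOpNorm B * ((matrixOpNorm B ^ 2 * (1 + matrixOpNorm B / 2 + Real.sqrt (matrixOpNorm B ^ 2 / 4 + 1 / (N : ℝ) ^ 2)) / (2 - 4 / (N : ℝ) ^ 2)) / 2 + Real.sqrt ((matrixOpNorm B ^ 2 * (1 + matrixOpNorm B / 2 + Real.sqrt (matrixOpNorm B ^ 2 / 4 + 1 / (N : ℝ) ^ 2)) / (2 - 4 / (N : ℝ) ^ 2)) ^ 2 / 4 + (matrixOpNorm B ^ 2 * (4 / (N : ℝ) ^ 2 + 2 * (matrixOpNorm B / 2 + Real.sqrt (matrixOpNorm B ^ 2 / 4 + 1 / (N : ℝ) ^ 2)) ^ 2) / (2 - 4 / (N : ℝ) ^ 2)))))) := mul_le_mul_of_nonneg_left (quad_scale_le hN B) (frobNorm_nonneg Δ)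

end Summit.Ventures.YMGap.OneLinkEigen
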